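import Literature.Topology.FourManifolds.LickorishTwistSurgery
import Literature.Topology.FourManifolds.KirbyMovesIsotopyProofs
import Literature.Topology.FourManifolds.IntegralSurgeryLinkSphere
import Literature.Topology.FourManifolds.KnotFraming
import Literature.Topology.FourManifolds.EquidimensionalEmbedding
import Literature.Topology.FourManifolds.TubularNbhdOfLocalDiffeomorph
import HarnessLib

/-!
# Iterated twist surgeries in `S³` and the resulting framed link

Topic `Literature/Topology/FourManifolds`; fourth file of the proof of leaf **F4** of the
Lickorish–Wallace DAG. From `LickorishTwistSurgery.lean` (one twist = one surgery) to Lickorish's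
statement for a whole product of twists (Ann. of Math. 76 (1962), p. 539: the twists are performed
one after the other, each toral hole inside the collar, "so `M` is homeomorphic to `S³` from which
disjoint solid tori have been removed, and are sewn back differently"; pp. 539–540: the process is
Wallace's *modification*, i.e. integral surgery). Everything here is proved.

* §1 `TubePresentation k P` — *`P` is presented by surgery on `k` pairwise disjoint tubes
  `T i : 𝕊 1 × ℝ² ↪ S³`*: the body of `Literature.Topology.FourManifolds.IsIntegralSurgeryLink` with
  bare tubes in place of framed oriented tubular neighbourhoods (`jA : S³ → P` a smooth embedding
  with open image off the cores, `jB i : D̊² × 𝕊 1 ↪ P`, cover, disjointness, seams `tubeRel`);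
  `TubePresentation.sphere` (`k = 0`).
* §2 `TubePresentation.step` — one more surgery along a tube `ν` of `P` which is `jA ∘ Tₙ` for a new
  tube `Tₙ` in `S³` disjoint from the old ones presents `ν.Surgered` by `k + 1` tubes (pointwise
  immersion criteria on open subsets of `S³`, `isImmersionAt_of_isSmoothEmbedding_restrict`,
  `isSmoothEmbedding_restrict_of_isImmersionAt`).
* §3 Orientation: the core of a smoothly embedded tube is a smooth knot (`knotOfTube`, zero section
  of a product neighbourhood); a smoothly embedded tube is an injective local diffeomorphism, so by
  the tree's `Knot.TubularNbhd.ofLocalDiffeomorph` (`TubularNbhdOfLocalDiffeomorph.lean`: the frame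
  determinant of `Knot.TubularNbhd.det_pos` has constant sign and the fibre reflection
  `(u, w) ↦ (u, w̄)` reverses it) **the tube or its fibre reflection is an oriented tubular
  neighbourhood of its core** (`exists_tubularNbhd_of_tube`), the surgery relation changing by the
  reflection `(p, v) ↦ (p, v̄)` of the solid torus (`torusFlip`).
* §4 `TubePresentation.exists_isIntegralSurgeryLink` — a tube presentation is an integral surgery
  presentation on a framed link (`Literature.Topology.FourManifolds.IsIntegralSurgeryLink`), the
  framings existing by `Knot.TubularNbhd.exists_hasFraming` (`DehnSurgeryFramingProofs.lean`).
* §5 The iteration (`IterGood`, `iterGood_step`, `iterGood_list`): starting from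
  `S³ = H ∪_{i₀} H'`, perform the surgeries of the Dehn twists `σ₁, …, σₙ` one after the other at the
  doubling collar depths `d_j = 3⁻¹ 2^{j-n}` (later = deeper, so that earlier collar twists are the
  identity on later tubes and all tubes are disjoint); invariant: the current embedding of `H` agrees
  with `jA ∘ jH₀` above the current threshold. **Result** (`exists_surgery_of_dehnTwists`): a closed
  `3`-manifold which is both `H ∪_{i₀ ∘ σ₁ ∘ ⋯ ∘ σₙ} H'` and integral surgery on a framed
  `n`-component link in `S³`.

## References

* W. B. R. Lickorish, Ann. of Math. 76 (1962), proof of Thm. 2 (pp. 538–540). [LickorishAnnals1962]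
* D. Rolfsen, *Knots and Links* (1976), §9.F–G. [Rolfsen1976]
-/

open scoped Manifold ContDiff Topology
open Set Function Metric

noncomputable section

namespace Literature.Topology.FourManifolds

universe u v

/-- Local notation: `𝔼 n` is the model Euclidean space `EuclideanSpace ℝ (Fin n)`. -/
local notation "𝔼 " n:arg => EuclideanSpace ℝ (Fin n)

/-- Local notation: `𝕊 n` is the unit sphere in `EuclideanSpace ℝ (Fin (n + 1))`. -/
local notation "𝕊 " n:arg => (Metric.sphere (0 : EuclideanSpace ℝ (Fin (n + 1))) 1)

attribute [local instance] fact_finrank_euclideanSpace_succ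

/-! ### Presentations of a manifold by surgery on finitely many tubes in `S³` -/

namespace LickorishTwist

section Presentation

/-- The union of the core circles of a family of tube maps `𝕊 1 × ℝ² → 𝕊 3`. [folklore] -/
def tubesCore {k : ℕ} (T : Fin k → (𝕊 1) × (𝔼 2) → 𝕊 3) : Set (𝕊 3) :=
  ⋃ i, range fun u : 𝕊 1 ↦ T i (u, 0)

/-- Membership in the union of the cores of a family of tubes. [folklore] -/
theorem mem_tubesCore_iff {k : ℕ} {T : Fin k → (𝕊 1) × (𝔼 2) → 𝕊 3} {x : 𝕊 3} :
    x ∈ tubesCore T ↔ ∃ i u, T i (u, 0) = x := by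
  simp [tubesCore]

/-- The union of the core circles is closed, for continuous tube maps. [folklore] -/
theorem isClosed_tubesCore {k : ℕ} {T : Fin k → (𝕊 1) × (𝔼 2) → 𝕊 3} (hT : ∀ i, Continuous (T i)) :
    IsClosed (tubesCore T) :=
  isClosed_iUnion_of_finite fun i ↦ (isCompact_range (by have := hT i; fun_prop)).isClosed

/-- The complement of the core circles, an open subset of `𝕊 3`. [folklore] -/
def tubesCompl {k : ℕ} (T : Fin k → (𝕊 1) × (𝔼 2) → 𝕊 3) (hT : ∀ i, Continuous (T i)) :
    TopologicalSpace.Opens (𝕊 3) :=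
  ⟨(tubesCore T)ᶜ, (isClosed_tubesCore hT).isOpen_compl⟩

/-- Membership in the open complement of the cores. [folklore] -/
@[simp] theorem mem_tubesCompl_iff {k : ℕ} {T : Fin k → (𝕊 1) × (𝔼 2) → 𝕊 3} (hT : ∀ i, Continuous (T i))
    (x : 𝕊 3) : x ∈ tubesCompl T hT ↔ x ∉ tubesCore T := Iff.rfl

/-- The **surgery relation of the `i`-th tube** between `S³ ∖ cores` and `D̊² × 𝕊 1`:
`a = T i (u, t • v) ∼ (t • u, v)`, `0 < t < 1` (the relation `Literature.Topology.FourManifolds.tubeSurgeryRel`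
/ `Knot.TubularNbhd.glueRel` for the bare map `T i`). [folklore] -/
def tubeRel (T : (𝕊 1) × (𝔼 2) → 𝕊 3) (a : 𝕊 3) (b : (𝔼 2) × (𝕊 1)) : Prop :=
  ∃ (u : 𝕊 1) (t : ℝ), t ∈ Ioo (0 : ℝ) 1 ∧ b.1 = t • (u : 𝔼 2) ∧ a = T (u, t • (b.2 : 𝔼 2))

variable (k : ℕ) (P : Type v) [TopologicalSpace P] [ChartedSpace (𝔼 3) P]

/-- **A presentation of `P` by surgery along `k` tubes in `S³`.** The data: pairwise disjoint
smooth open embeddings `T i : 𝕊 1 × ℝ² ↪ S³` (the tubes; their zero sections are the components of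
the surgery link), a map `jA : S³ → P` which is a smooth embedding with open range on the complement
of the core circles, and smooth open embeddings `jB i : D̊² × 𝕊 1 ↪ P` of the new solid tori, with
pairwise disjoint ranges, such that the images cover `P` and `jA a = jB i b` exactly when `a`, `b`
are related by the surgery relation of the `i`-th tube. This is the body of
`Literature.Topology.FourManifolds.IsIntegralSurgeryLink` with bare tubes in place of framed oriented
tubular neighbourhoods (Rolfsen, *Knots and Links* (1976), §9.F). [folklore] -/
structure TubePresentation where
  /-- The tubes in `S³`. -/
  T : Fin k → (𝕊 1) × (𝔼 2) → 𝕊 3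
  /-- Each tube is a smooth embedding. -/
  isSmoothEmbedding_T : ∀ i, Manifold.IsSmoothEmbedding ((𝓡 1).prod 𝓘(ℝ, 𝔼 2)) (𝓡 3) ∞ (T i)
  /-- The tubes are pairwise disjoint. -/
  disjoint_T : Pairwise fun i j ↦ Disjoint (range (T i)) (range (T j))
  /-- The embedding of the complement of the cores (junk on the cores). -/
  jA : 𝕊 3 → P
  /-- The embeddings of the new solid tori. -/
  jB : Fin k → ↥solidTorus → P
  /-- `jA` is a smooth embedding on the complement of the cores. -/
  isSmoothEmbedding_jA : Manifold.IsSmoothEmbedding (𝓡 3) (𝓡 3) ∞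
    fun a : ↥(tubesCompl T fun i ↦ (isSmoothEmbedding_T i).isEmbedding.continuous) ↦ jA a
  /-- The image of the complement of the cores is open. -/
  isOpen_image_jA : IsOpen (jA '' (tubesCore T)ᶜ)
  /-- Each `jB i` is a smooth embedding. -/
  isSmoothEmbedding_jB : ∀ i, Manifold.IsSmoothEmbedding (𝓘(ℝ, 𝔼 2).prod (𝓡 1)) (𝓡 3) ∞ (jB i)
  /-- Each `jB i` has open range. -/
  isOpen_range_jB : ∀ i, IsOpen (range (jB i))
  /-- The images cover `P`. -/
  cover : jA '' (tubesCore T)ᶜ ∪ (⋃ i, range (jB i)) = univ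
  /-- The new solid tori are pairwise disjoint. -/
  disjoint_jB : Pairwise fun i j ↦ Disjoint (range (jB i)) (range (jB j))
  /-- The seam: `jA a = jB i b` iff `a ∼ b` for the `i`-th tube. -/
  rel : ∀ i (a : 𝕊 3), a ∉ tubesCore T → ∀ b : ↥solidTorus, jA a = jB i b ↔ tubeRel (T i) a b

namespace TubePresentation

variable {k P} (pr : TubePresentation k P)

/-- The tubes of a presentation are continuous. [folklore] -/
theorem continuous_T (i : Fin k) : Continuous (pr.T i) := (pr.isSmoothEmbedding_T i).isEmbedding.continuous

/-- The tubes of a presentation are injective. [folklore] -/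
theorem injective_T (i : Fin k) : Injective (pr.T i) := (pr.isSmoothEmbedding_T i).isEmbedding.injective

/-- The complement of the cores of a presentation. [folklore] -/
abbrev compl : TopologicalSpace.Opens (𝕊 3) := tubesCompl pr.T pr.continuous_T

/-- `jA` is injective off the cores. [folklore] -/
theorem injOn_jA : InjOn pr.jA (tubesCore pr.T)ᶜ := by
  intro a ha a' ha' h
  have := pr.isSmoothEmbedding_jA.isEmbedding.injective (a₁ := ⟨a, ha⟩) (a₂ := ⟨a', ha'⟩) h
  exact congrArg Subtype.val this

/-- `jA` is continuous off the cores. [folklore] -/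
theorem continuousOn_jA : ContinuousOn pr.jA (tubesCore pr.T)ᶜ := by
  rw [continuousOn_iff_continuous_restrict]
  exact pr.isSmoothEmbedding_jA.isEmbedding.continuous

/-- A point of a tube off the zero section is off all the cores. [folklore] -/
theorem apply_not_mem_tubesCore {i : Fin k} {q : (𝕊 1) × (𝔼 2)} (hq : q.2 ≠ 0) :
    pr.T i q ∉ tubesCore pr.T := by
  rintro ⟨_, ⟨j, rfl⟩, u, hu⟩
  simp only at hu
  by_cases hij : j = i
  · subst hij
    exact hq (congrArg Prod.snd (pr.injective_T j hu)).symm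
  · have h1 : pr.T i q ∈ range (pr.T j) := ⟨(u, 0), hu⟩
    exact Set.disjoint_left.1 (pr.disjoint_T hij) h1 (mem_range_self _)

/-- A point of the core of the `i`-th tube. [folklore] -/
theorem apply_zero_mem_tubesCore (i : Fin k) (u : 𝕊 1) : pr.T i (u, 0) ∈ tubesCore pr.T :=
  mem_iUnion.2 ⟨i, u, rfl⟩

/-- `jA` of a punctured tube point lies in the `i`-th new solid torus. [folklore] -/
theorem jA_apply_mem_range_jB {i : Fin k} {q : (𝕊 1) × (𝔼 2)} (hq0 : q.2 ≠ 0) (hq1 : ‖q.2‖ < 1) :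
    pr.jA (pr.T i q) ∈ range (pr.jB i) := by
  obtain ⟨u, w⟩ := q
  have hw : 0 < ‖w‖ := norm_pos_iff.2 hq0
  refine ⟨⟨(‖w‖ • (u : 𝔼 2), radialProjection (spherePt 1) w), by rw [mem_solidTorus_iff, norm_smul_coe_sphere hw.le]; exact hq1⟩, ?_⟩
  symm
  rw [pr.rel i _ (pr.apply_not_mem_tubesCore hq0)]
  exact ⟨u, ‖w‖, ⟨hw, hq1⟩, rfl, by simp only [norm_smul_coe_radialProjection]⟩

/-- Conversely a point of `jA (S³ ∖ cores)` in the `i`-th new solid torus comes from the punctured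
unit tube. [folklore] -/
theorem exists_eq_T_of_jA_eq_jB {i : Fin k} {a : 𝕊 3} (ha : a ∉ tubesCore pr.T) {b : ↥solidTorus}
    (hab : pr.jA a = pr.jB i b) : ∃ q : (𝕊 1) × (𝔼 2), q.2 ≠ 0 ∧ ‖q.2‖ < 1 ∧ a = pr.T i q := by
  obtain ⟨u, t, ht, -, rfl⟩ := (pr.rel i a ha b).1 hab
  refine ⟨(u, t • (b : (𝔼 2) × (𝕊 1)).2), ?_, ?_, rfl⟩
  · simp [ht.1.ne', ne_zero_of_mem_unit_sphere]
  · simp only [norm_smul_coe_sphere ht.1.le]; exact ht.2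

end TubePresentation

/-! #### The trivial presentation of `S³` -/

/-- **`S³` is presented by surgery on no tubes** (the identity on `S³`). [folklore] -/
def TubePresentation.sphere : TubePresentation 0 (𝕊 3) where
  T := Fin.elim0
  isSmoothEmbedding_T i := i.elim0
  disjoint_T i := i.elim0
  jA := id
  jB := Fin.elim0
  isSmoothEmbedding_jA := Manifold.IsSmoothEmbedding.of_opens _
  isOpen_image_jA := by
    rw [image_id]
    exact (isClosed_tubesCore fun i ↦ i.elim0).isOpen_compl
  isSmoothEmbedding_jB i := i.elim0
  isOpen_range_jB i := i.elim0
  cover := by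
    rw [image_id, eq_univ_iff_forall]
    intro x
    left
    simp [tubesCore]
  disjoint_jB i := i.elim0
  rel i := i.elim0

end Presentation

/-! ### Pointwise immersions on an open subset of `S³` versus packaged smooth embeddings -/

section Pointwise

variable {Q : Type v} [TopologicalSpace Q] [ChartedSpace (𝔼 3) Q] [IsManifold (𝓡 3) ∞ Q]

omit [IsManifold (𝓡 3) ∞ Q] in
/-- **From the packaged embedding to pointwise immersions**: if `f ∘ val : ↥U → Q` is a smooth
embedding then `f` is an immersion (of `S³`) at every point of `U`. [folklore] -/
theorem isImmersionAt_of_isSmoothEmbedding_restrict {f : 𝕊 3 → Q} {U : TopologicalSpace.Opens (𝕊 3)}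
    (hf : Manifold.IsSmoothEmbedding (𝓡 3) (𝓡 3) ∞ fun a : ↥U ↦ f a) {a : 𝕊 3} (ha : a ∈ U) :
    Manifold.IsImmersionAt (𝓡 3) (𝓡 3) ∞ f a := by
  haveI hU : Nonempty U := ⟨⟨a, ha⟩⟩
  obtain ⟨F, _, _, hF⟩ := hf.isImmersion
  have h := hF ⟨a, ha⟩
  set c := U.openPartialHomeomorphSubtypeCoe hU with hc
  have hat : a ∈ c.target := by rw [hc, U.openPartialHomeomorphSubtypeCoe_target]; exact ha
  have hsrc : a ∈ c.symm.source := hat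
  have hpt : c.symm a = ⟨a, ha⟩ := by
    have h1 : (c (c.symm a) : 𝕊 3) = a := c.right_inv hat
    exact Subtype.ext (by simpa [hc] using h1)
  have h' : Manifold.IsImmersionAtOfComplement F (𝓡 3) (𝓡 3) ∞
      (fun a : ↥U ↦ f a) (c.symm a) := by rw [hpt]; exact h
  have hΦ : ContMDiffOn (𝓡 3) (𝓡 3) ∞ c.symm c.symm.source :=
    contMDiffOn_openPartialHomeomorphSubtypeCoe_symm U hU
  have hΦ' : ContMDiffOn (𝓡 3) (𝓡 3) ∞ c.symm.symm c.symm.target := by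
    rw [OpenPartialHomeomorph.symm_symm, OpenPartialHomeomorph.symm_target]
    exact contMDiffOn_openPartialHomeomorphSubtypeCoe U hU
  have h1 := h'.comp_openPartialHomeomorph c.symm hΦ hΦ' hsrc
  have h2 : Manifold.IsImmersionAtOfComplement F (𝓡 3) (𝓡 3) ∞ f a := by
    refine h1.congr_of_eventuallyEq (Filter.eventuallyEq_of_mem (U.isOpen.mem_nhds ha) fun x hx ↦ ?_)
    show f ((c.symm x : ↥U) : 𝕊 3) = f x
    congr 1
    have hxt : x ∈ c.target := by rw [hc, U.openPartialHomeomorphSubtypeCoe_target]; exact hx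
    simpa [hc] using c.right_inv hxt
  exact h2.isImmersionAt

/-- **From pointwise immersions to the packaged embedding**: a map `f : S³ → Q` into a boundaryless
`3`-manifold which is an immersion at every point of an open set `U` and injective on `U` restricts
to a smooth embedding of `U` with open image (equidimensional immersions are local diffeomorphisms,
hence open). [folklore] -/
theorem isSmoothEmbedding_restrict_of_isImmersionAt {f : 𝕊 3 → Q} {U : TopologicalSpace.Opens (𝕊 3)}
    (himm : ∀ a ∈ U, Manifold.IsImmersionAt (𝓡 3) (𝓡 3) ∞ f a) (hinj : InjOn f U) :
    Manifold.IsSmoothEmbedding (𝓡 3) (𝓡 3) ∞ (fun a : ↥U ↦ f a) ∧ IsOpen (f '' U) := by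
  -- immersion of the restriction at every point, with the trivial complement
  have h1 : ∀ y : ↥U, Manifold.IsImmersionAtOfComplement (EuclideanSpace ℝ (Fin 0)) (𝓡 3) (𝓡 3) ∞
      (fun a : ↥U ↦ f a) y := fun y ↦ by
    have h := (himm y y.2).isImmersionAtOfComplement_complement
    have h' := h.comp_subtypeVal U (y := y)
    exact h'.of_finrank_eq (by simp)
  have himm' : Manifold.IsImmersion (𝓡 3) (𝓡 3) ∞ (fun a : ↥U ↦ f a) :=
    Manifold.IsImmersionOfComplement.isImmersion h1
  have hloc : IsLocalDiffeomorph (𝓡 3) (𝓡 3) ∞ (fun a : ↥U ↦ f a) := fun y ↦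
    Manifold.IsImmersionAt.isLocalDiffeomorphAt_of_finrank_eq (himm'.isImmersionAt y) rfl
  have hcont : Continuous (fun a : ↥U ↦ f a) := hloc.contMDiff.continuous
  have hinj' : Injective (fun a : ↥U ↦ f a) := fun y y' h ↦ Subtype.ext (hinj y.2 y'.2 h)
  have hopen : IsOpenMap (fun a : ↥U ↦ f a) := hloc.isOpenMap
  refine ⟨⟨himm', (Topology.IsOpenEmbedding.of_continuous_injective_isOpenMap hcont hinj' hopen).isEmbedding⟩, ?_⟩
  have : f '' (U : Set (𝕊 3)) = range (fun a : ↥U ↦ f a) := by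
    ext q; constructor
    · rintro ⟨a, ha, rfl⟩; exact ⟨⟨a, ha⟩, rfl⟩
    · rintro ⟨⟨a, ha⟩, rfl⟩; exact ⟨a, ha, rfl⟩
  rw [this]
  exact hopen.isOpen_range

end Pointwise

/-! ### One more surgery: the presentation of the surgered manifold -/

section Step

/-- Membership in the cores of an extended family of tubes. [folklore] -/
theorem mem_tubesCore_snoc_iff {k : ℕ} {T : Fin k → (𝕊 1) × (𝔼 2) → 𝕊 3} {Tn : (𝕊 1) × (𝔼 2) → 𝕊 3}
    {x : 𝕊 3} : x ∈ tubesCore (Fin.snoc T Tn : Fin (k + 1) → (𝕊 1) × (𝔼 2) → 𝕊 3) ↔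
      x ∈ tubesCore T ∨ x ∈ range fun u : 𝕊 1 ↦ Tn (u, 0) := by
  simp only [mem_tubesCore_iff, mem_range]
  rw [Fin.exists_fin_succ']
  simp [Fin.snoc_castSucc, Fin.snoc_last]

variable {k : ℕ} {P : Type v} [TopologicalSpace P] [T2Space P] [ChartedSpace (𝔼 3) P]
  (pr : TubePresentation k P) {cc : 𝕊 1 → P} (ν : TubeNbhd (𝓡 3) cc)
  {Tn : (𝕊 1) × (𝔼 2) → 𝕊 3}
  (hdisj : ∀ i, Disjoint (range Tn) (range (pr.T i))) (hν : ∀ q, ν.toFun q = pr.jA (Tn q))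

namespace TubePresentation

omit [T2Space P] in
include hdisj in
/-- The new tube misses the old cores. [folklore] -/
theorem new_not_mem_tubesCore (q : (𝕊 1) × (𝔼 2)) : Tn q ∉ tubesCore pr.T := by
  rintro ⟨_, ⟨i, rfl⟩, u, hu⟩
  exact Set.disjoint_left.1 (hdisj i) (mem_range_self q) ⟨(u, 0), hu⟩

omit [T2Space P] in
include hν in
/-- The core circle of `ν` is `jA` of the core of the new tube. [folklore] -/
theorem core_eq (u : 𝕊 1) : cc u = pr.jA (Tn (u, 0)) := by rw [← ν.apply_zero, hν]

include hdisj hν in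
/-- The old solid tori miss the core circle of `ν`. [folklore] -/
theorem jB_mem_complement (i : Fin k) (b : ↥solidTorus) : pr.jB i b ∈ ν.complement := by
  rw [TubeNbhd.mem_complement_iff]
  rintro ⟨u, hu⟩
  rw [pr.core_eq ν hν] at hu
  obtain ⟨q, -, -, hq⟩ := pr.exists_eq_T_of_jA_eq_jB (i := i) (pr.new_not_mem_tubesCore hdisj (u, 0)) hu
  exact Set.disjoint_left.1 (hdisj i) (mem_range_self (u, 0)) ⟨q, hq.symm⟩

include hdisj hν in
/-- Off the new cores, `jA` misses the core circle of `ν`. [folklore] -/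
theorem jA_mem_complement {x : 𝕊 3}
    (hx : x ∉ tubesCore (Fin.snoc pr.T Tn : Fin (k + 1) → (𝕊 1) × (𝔼 2) → 𝕊 3)) :
    pr.jA x ∈ ν.complement := by
  rw [mem_tubesCore_snoc_iff, not_or] at hx
  rw [TubeNbhd.mem_complement_iff]
  rintro ⟨u, hu⟩
  rw [pr.core_eq ν hν] at hu
  have := pr.injOn_jA (pr.new_not_mem_tubesCore hdisj (u, 0)) hx.1 hu
  exact hx.2 ⟨u, this⟩

open Classical in
/-- The map `S³ → P ∖ core` underlying the new `jA`: `jA` where it misses the core of `ν` (junk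
elsewhere). [folklore] -/
def stepBase (x : 𝕊 3) : ↥ν.complement :=
  if h : pr.jA x ∈ ν.complement then ⟨pr.jA x, h⟩ else ν.basePtA

/-- Where `jA x` misses the core of `ν`, `stepBase x` is `jA x`. [folklore] -/
theorem coe_stepBase {x : 𝕊 3} (h : pr.jA x ∈ ν.complement) : (pr.stepBase ν x : P) = pr.jA x := by
  rw [stepBase, dif_pos h]

/-- **The new `jA`**: `inl ∘ jA`. [folklore] -/
def stepA (x : 𝕊 3) : ν.Surgered := ν.glueData.inl (pr.stepBase ν x)

/-- Where `jA x` misses the core of `ν`, the new `jA` is `inl (jA x)`. [folklore] -/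
theorem stepA_apply {x : 𝕊 3} (h : pr.jA x ∈ ν.complement) :
    pr.stepA ν x = ν.glueData.inl ⟨pr.jA x, h⟩ := by
  rw [stepA]; congr 1; exact Subtype.ext (pr.coe_stepBase ν h)

/-- **The new solid tori**: the old ones through `inl`, and the new one `inr`. [folklore] -/
def stepB : Fin (k + 1) → ↥solidTorus → ν.Surgered :=
  Fin.snoc (fun i b ↦ ν.glueData.inl ⟨pr.jB i b, pr.jB_mem_complement ν hdisj hν i b⟩) ν.glueData.inr

/-- The old solid tori of the new presentation are `inl ∘ jB i`. [folklore] -/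
theorem stepB_castSucc (i : Fin k) (b : ↥solidTorus) :
    pr.stepB ν hdisj hν i.castSucc b = ν.glueData.inl ⟨pr.jB i b, pr.jB_mem_complement ν hdisj hν i b⟩ := by
  rw [stepB, Fin.snoc_castSucc]

/-- The last solid torus of the new presentation is `inr`. [folklore] -/
theorem stepB_last (b : ↥solidTorus) : pr.stepB ν hdisj hν (Fin.last k) b = ν.glueData.inr b := by
  rw [stepB, Fin.snoc_last]

/-! #### The new `jA` is a smooth embedding off the new cores -/

/-- The set where `jA` misses the core of `ν` is an open neighbourhood of the complement of the new
cores, inside the complement of the old cores. [folklore] -/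
theorem isOpen_goodSet : IsOpen {x : 𝕊 3 | x ∉ tubesCore pr.T ∧ pr.jA x ∈ ν.complement} := by
  have h1 : IsOpen (tubesCore pr.T)ᶜ := (isClosed_tubesCore pr.continuous_T).isOpen_compl
  exact pr.continuousOn_jA.isOpen_inter_preimage h1 ν.complement.isOpen

include hdisj hν in
/-- **The new `jA` is an immersion at every point off the new cores.** [folklore] -/
theorem isImmersionAt_stepA [IsManifold (𝓡 3) ∞ P] {a : 𝕊 3}
    (ha : a ∉ tubesCore (Fin.snoc pr.T Tn : Fin (k + 1) → (𝕊 1) × (𝔼 2) → 𝕊 3)) :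
    Manifold.IsImmersionAt (𝓡 3) 𝓘(ℝ, 𝔼 3) ∞ (pr.stepA ν) a := by
  have ha' := ha
  rw [mem_tubesCore_snoc_iff, not_or] at ha'
  have hmem := pr.jA_mem_complement ν hdisj hν ha
  -- `jA` is an immersion of `S³` at `a`
  have hA := isImmersionAt_of_isSmoothEmbedding_restrict pr.isSmoothEmbedding_jA ha'.1
  have h0 := hA.isImmersionAtOfComplement_complement
  -- so is the underlying map of `stepBase`, which agrees with it near `a`
  have h1 : Manifold.IsImmersionAtOfComplement hA.complement (𝓡 3) (𝓡 3) ∞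
      (fun x ↦ (pr.stepBase ν x : P)) a := by
    refine h0.congr_of_eventuallyEq (Filter.eventuallyEq_of_mem ((pr.isOpen_goodSet ν).mem_nhds ⟨ha'.1, hmem⟩)
      fun x hx ↦ ?_)
    exact (pr.coe_stepBase ν hx.2).symm
  have h2 : Manifold.IsImmersionAtOfComplement hA.complement (𝓡 3) (𝓡 3) ∞ (pr.stepBase ν) a := by
    have := h1.codRestrict_opens ν.complement (fun x ↦ (pr.stepBase ν x).2)
    exact this
  exact (ν.glueData.isImmersionAtOfComplement_inl_comp h2).isImmersionAt

include hdisj hν in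
/-- The new `jA` is injective off the new cores. [folklore] -/
theorem injOn_stepA : InjOn (pr.stepA ν) (tubesCore (Fin.snoc pr.T Tn : Fin (k + 1) → (𝕊 1) × (𝔼 2) → 𝕊 3))ᶜ := by
  intro x hx y hy hxy
  rw [pr.stepA_apply ν (pr.jA_mem_complement ν hdisj hν hx), pr.stepA_apply ν (pr.jA_mem_complement ν hdisj hν hy)] at hxy
  have := congrArg Subtype.val (ν.glueData.inl_injective hxy)
  have hx' := hx; have hy' := hy
  rw [mem_compl_iff, mem_tubesCore_snoc_iff, not_or] at hx' hy'
  exact pr.injOn_jA hx'.1 hy'.1 this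

/-! #### The new solid tori -/

include hdisj hν in
/-- The old solid tori, pushed through `inl`, are smooth embeddings. [folklore] -/
theorem isSmoothEmbedding_stepB_castSucc [IsManifold (𝓡 3) ∞ P] (i : Fin k) :
    Manifold.IsSmoothEmbedding (𝓘(ℝ, 𝔼 2).prod (𝓡 1)) 𝓘(ℝ, 𝔼 3) ∞ (pr.stepB ν hdisj hν i.castSucc) := by
  have hg : Manifold.IsSmoothEmbedding (𝓘(ℝ, 𝔼 2).prod (𝓡 1)) (𝓡 3) ∞
      fun b : ↥solidTorus ↦ (⟨pr.jB i b, pr.jB_mem_complement ν hdisj hν i b⟩ : ↥ν.complement) := by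
    obtain ⟨F, _, _, hF⟩ := (pr.isSmoothEmbedding_jB i).isImmersion
    refine ⟨Manifold.IsImmersionOfComplement.isImmersion (F := F) fun b ↦ ?_,
      Topology.IsEmbedding.of_comp ((pr.isSmoothEmbedding_jB i).isEmbedding.continuous.subtype_mk _)
        continuous_subtype_val (pr.isSmoothEmbedding_jB i).isEmbedding⟩
    exact (hF b).codRestrict_opens ν.complement (fun b ↦ pr.jB_mem_complement ν hdisj hν i b)
  have heq : pr.stepB ν hdisj hν i.castSucc =
      ν.glueData.inl ∘ fun b : ↥solidTorus ↦ (⟨pr.jB i b, pr.jB_mem_complement ν hdisj hν i b⟩ : ↥ν.complement) :=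
    funext fun b ↦ pr.stepB_castSucc ν hdisj hν i b
  rw [heq]
  exact ν.glueData.isSmoothEmbedding_inl_comp hg

include hdisj hν in
/-- The range of an old solid torus of the new presentation is `inl` of the old range. [folklore] -/
theorem range_stepB_castSucc (i : Fin k) :
    range (pr.stepB ν hdisj hν i.castSucc) = ν.glueData.inl '' ((↑) ⁻¹' range (pr.jB i)) := by
  ext p
  simp only [mem_range, mem_image, mem_preimage, pr.stepB_castSucc ν hdisj hν]
  constructor
  · rintro ⟨b, rfl⟩
    exact ⟨⟨pr.jB i b, pr.jB_mem_complement ν hdisj hν i b⟩, ⟨b, rfl⟩, rfl⟩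
  · rintro ⟨⟨x, hx⟩, ⟨b, hb⟩, rfl⟩
    exact ⟨b, by congr 1; exact Subtype.ext hb⟩

include hdisj hν in
/-- The solid tori of the new presentation have open ranges. [folklore] -/
theorem isOpen_range_stepB (i : Fin (k + 1)) : IsOpen (range (pr.stepB ν hdisj hν i)) := by
  rcases Fin.eq_castSucc_or_eq_last i with ⟨j, rfl⟩ | rfl
  · rw [pr.range_stepB_castSucc ν hdisj hν j]
    exact ν.glueData.isOpenMap_inl _ ((pr.isOpen_range_jB j).preimage continuous_subtype_val)
  · have : pr.stepB ν hdisj hν (Fin.last k) = ν.glueData.inr := funext fun b ↦ pr.stepB_last ν hdisj hν b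
    rw [this]
    exact ν.glueData.isOpen_range_inr

/-! #### Cover, disjointness and the seams -/

omit [T2Space P] in
include hdisj hν in
/-- A point of the punctured unit tube of `ν` is `jA` of a point of the punctured new tube. [folklore] -/
theorem eq_new_of_mem_puncturedTube {x : 𝕊 3} (hx : x ∉ tubesCore pr.T) (hp : pr.jA x ∈ ν.puncturedTube) :
    ∃ q : (𝕊 1) × (𝔼 2), q.2 ≠ 0 ∧ ‖q.2‖ < 1 ∧ x = Tn q := by
  obtain ⟨q, hq, hqx⟩ := hp
  rw [hν] at hqx
  exact ⟨q, hq.1, hq.2, (pr.injOn_jA hx (pr.new_not_mem_tubesCore hdisj q) hqx.symm)⟩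

include hdisj hν in
/-- **The images cover the surgered manifold.** [folklore] -/
theorem stepA_cover : pr.stepA ν '' (tubesCore (Fin.snoc pr.T Tn : Fin (k + 1) → (𝕊 1) × (𝔼 2) → 𝕊 3))ᶜ ∪
    (⋃ i, range (pr.stepB ν hdisj hν i)) = univ := by
  refine eq_univ_of_forall fun p ↦ ?_
  rcases ν.glueData.exists_inl_or_inr p with ⟨⟨y, hy⟩, rfl⟩ | ⟨b, rfl⟩
  · -- `y ∈ P` off the core of `ν`: `y = jA x` with `x` off the old cores, or `y` in an old torus
    rcases (pr.cover ▸ mem_univ y : y ∈ pr.jA '' (tubesCore pr.T)ᶜ ∪ ⋃ i, range (pr.jB i)) with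
      ⟨x, hx, rfl⟩ | hyB
    · left
      have hx' : x ∉ tubesCore (Fin.snoc pr.T Tn : Fin (k + 1) → (𝕊 1) × (𝔼 2) → 𝕊 3) := by
        rw [mem_tubesCore_snoc_iff, not_or]
        refine ⟨hx, ?_⟩
        rintro ⟨u, rfl⟩
        exact (TubeNbhd.mem_complement_iff ν _).1 hy ⟨u, pr.core_eq ν hν u⟩
      exact ⟨x, hx', pr.stepA_apply ν hy⟩
    · right
      obtain ⟨i, b, rfl⟩ : ∃ i b, pr.jB i b = y := by simpa only [mem_iUnion, mem_range] using hyB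
      exact mem_iUnion.2 ⟨i.castSucc, b, pr.stepB_castSucc ν hdisj hν i b⟩
  · right
    exact mem_iUnion.2 ⟨Fin.last k, b, pr.stepB_last ν hdisj hν b⟩

include hdisj hν in
/-- An old torus (through `inl`) never meets the new torus `inr`. [folklore] -/
theorem stepB_castSucc_ne_inr (i : Fin k) (b b' : ↥solidTorus) :
    pr.stepB ν hdisj hν i.castSucc b ≠ ν.glueData.inr b' := by
  rw [pr.stepB_castSucc ν hdisj hν]
  intro h
  obtain ⟨ha, -⟩ := ν.glueData.inl_eq_inr_iff.1 h
  rw [TubeNbhd.glueData_glue, TubeNbhd.glue_source] at ha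
  -- `jB i b` lies in the punctured tube of `ν`, i.e. is `jA` of a punctured new-tube point
  obtain ⟨q, hq, hqx⟩ := ha
  rw [hν] at hqx
  obtain ⟨q', -, -, hq'⟩ := pr.exists_eq_T_of_jA_eq_jB (i := i) (pr.new_not_mem_tubesCore hdisj q) hqx
  exact Set.disjoint_left.1 (hdisj i) (mem_range_self q) ⟨q', hq'.symm⟩

include hdisj hν in
/-- **The new solid tori are pairwise disjoint.** [folklore] -/
theorem disjoint_stepB : Pairwise fun i j ↦ Disjoint (range (pr.stepB ν hdisj hν i)) (range (pr.stepB ν hdisj hν j)) := by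
  intro i j hij
  rcases Fin.eq_castSucc_or_eq_last i with ⟨i', rfl⟩ | rfl <;>
    rcases Fin.eq_castSucc_or_eq_last j with ⟨j', rfl⟩ | rfl
  · have hij' : i' ≠ j' := fun h ↦ hij (by rw [h])
    rw [pr.range_stepB_castSucc ν hdisj hν, pr.range_stepB_castSucc ν hdisj hν]
    exact (Disjoint.preimage _ (pr.disjoint_jB hij')).image ν.glueData.inl_injective.injOn
      (subset_univ _) (subset_univ _)
  · exact Set.disjoint_left.2 fun p ⟨b, hb⟩ ⟨b', hb'⟩ ↦
      pr.stepB_castSucc_ne_inr ν hdisj hν i' b b' (hb.trans (hb'.symm.trans (pr.stepB_last ν hdisj hν b')))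
  · exact Set.disjoint_left.2 fun p ⟨b, hb⟩ ⟨b', hb'⟩ ↦
      pr.stepB_castSucc_ne_inr ν hdisj hν j' b' b (hb'.trans (hb.symm.trans (pr.stepB_last ν hdisj hν b)))
  · exact (hij rfl).elim

include hdisj hν in
/-- **The seam with an old torus**: the old relation. [folklore] -/
theorem stepA_eq_stepB_castSucc_iff (i : Fin k) {a : 𝕊 3}
    (ha : a ∉ tubesCore (Fin.snoc pr.T Tn : Fin (k + 1) → (𝕊 1) × (𝔼 2) → 𝕊 3)) (b : ↥solidTorus) :
    pr.stepA ν a = pr.stepB ν hdisj hν i.castSucc b ↔ tubeRel (pr.T i) a b := by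
  have ha' := ha
  rw [mem_tubesCore_snoc_iff, not_or] at ha'
  rw [pr.stepA_apply ν (pr.jA_mem_complement ν hdisj hν ha), pr.stepB_castSucc ν hdisj hν,
    (ν.glueData.inl_injective).eq_iff, Subtype.mk.injEq, pr.rel i a ha'.1 b]

include hdisj hν in
/-- **The seam with the new torus**: the surgery relation of the new tube. [folklore] -/
theorem stepA_eq_inr_iff {a : 𝕊 3}
    (ha : a ∉ tubesCore (Fin.snoc pr.T Tn : Fin (k + 1) → (𝕊 1) × (𝔼 2) → 𝕊 3)) (b : ↥solidTorus) :
    pr.stepA ν a = ν.glueData.inr b ↔ tubeRel Tn a b := by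
  have ha' := ha
  rw [mem_tubesCore_snoc_iff, not_or] at ha'
  rw [pr.stepA_apply ν (pr.jA_mem_complement ν hdisj hν ha), SmoothGlueData.inl_eq_inr_iff,
    ← TubeNbhd.tubeSurgeryRel_iff]
  -- `tubeSurgeryRel ν (jA a) b ↔ tubeRel Tn a b`, by injectivity of `jA` off the old cores
  simp only [tubeSurgeryRel, tubeRel, hν]
  constructor
  · rintro ⟨u, t, ht, hb, hab⟩
    exact ⟨u, t, ht, hb, pr.injOn_jA ha'.1 (pr.new_not_mem_tubesCore hdisj _) hab⟩
  · rintro ⟨u, t, ht, hb, rfl⟩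
    exact ⟨u, t, ht, hb, rfl⟩

include hdisj hν in
/-- The new `jA` restricts to a smooth embedding with open image off the new cores. [folklore] -/
theorem stepA_emb [IsManifold (𝓡 3) ∞ P]
    (hc : ∀ i, Continuous ((Fin.snoc pr.T Tn : Fin (k + 1) → (𝕊 1) × (𝔼 2) → 𝕊 3) i)) :
    Manifold.IsSmoothEmbedding (𝓡 3) (𝓡 3) ∞
        (fun a : ↥(tubesCompl (Fin.snoc pr.T Tn : Fin (k + 1) → (𝕊 1) × (𝔼 2) → 𝕊 3) hc) ↦ pr.stepA ν a) ∧
      IsOpen (pr.stepA ν '' (tubesCore (Fin.snoc pr.T Tn : Fin (k + 1) → (𝕊 1) × (𝔼 2) → 𝕊 3))ᶜ) :=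
  isSmoothEmbedding_restrict_of_isImmersionAt
    (U := tubesCompl (Fin.snoc pr.T Tn : Fin (k + 1) → (𝕊 1) × (𝔼 2) → 𝕊 3) hc) (f := pr.stepA ν)
    (fun _ ha ↦ pr.isImmersionAt_stepA ν hdisj hν ha) (pr.injOn_stepA ν hdisj hν)

omit [T2Space P] in
/-- Continuity of the extended family of tubes. [folklore] -/
theorem continuous_snoc (hTn : Manifold.IsSmoothEmbedding ((𝓡 1).prod 𝓘(ℝ, 𝔼 2)) (𝓡 3) ∞ Tn)
    (i : Fin (k + 1)) : Continuous ((Fin.snoc pr.T Tn : Fin (k + 1) → (𝕊 1) × (𝔼 2) → 𝕊 3) i) := by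
  rcases Fin.eq_castSucc_or_eq_last i with ⟨j, rfl⟩ | rfl
  · rw [Fin.snoc_castSucc]; exact pr.continuous_T j
  · rw [Fin.snoc_last]; exact hTn.isEmbedding.continuous

/-- **One more surgery.** From a presentation of `P` by surgery on `k` tubes in `S³`, a tube `ν`
in `P` which is `jA` of a new tube `Tn` in `S³` disjoint from the old ones, the presentation of the
surgered manifold `ν.Surgered` by surgery on the `k + 1` tubes. [folklore] -/
def step [IsManifold (𝓡 3) ∞ P] (hTn : Manifold.IsSmoothEmbedding ((𝓡 1).prod 𝓘(ℝ, 𝔼 2)) (𝓡 3) ∞ Tn) :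
    TubePresentation (k + 1) ν.Surgered where
  T := Fin.snoc pr.T Tn
  isSmoothEmbedding_T i := by
    rcases Fin.eq_castSucc_or_eq_last i with ⟨j, rfl⟩ | rfl
    · rw [Fin.snoc_castSucc]; exact pr.isSmoothEmbedding_T j
    · rw [Fin.snoc_last]; exact hTn
  disjoint_T i j hij := by
    rcases Fin.eq_castSucc_or_eq_last i with ⟨i', rfl⟩ | rfl <;>
      rcases Fin.eq_castSucc_or_eq_last j with ⟨j', rfl⟩ | rfl
    · simp only [Fin.snoc_castSucc]
      exact pr.disjoint_T fun h ↦ hij (by rw [h])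
    · simp only [Fin.snoc_castSucc, Fin.snoc_last]; exact (hdisj i').symm
    · simp only [Fin.snoc_castSucc, Fin.snoc_last]; exact hdisj j'
    · exact (hij rfl).elim
  jA := pr.stepA ν
  jB := pr.stepB ν hdisj hν
  isSmoothEmbedding_jA := (pr.stepA_emb ν hdisj hν (pr.continuous_snoc hTn)).1
  isOpen_image_jA := (pr.stepA_emb ν hdisj hν (pr.continuous_snoc hTn)).2
  isSmoothEmbedding_jB i := by
    rcases Fin.eq_castSucc_or_eq_last i with ⟨j, rfl⟩ | rfl
    · exact pr.isSmoothEmbedding_stepB_castSucc ν hdisj hν j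
    · have : pr.stepB ν hdisj hν (Fin.last k) = ν.glueData.inr := funext fun b ↦ pr.stepB_last ν hdisj hν b
      rw [this]; exact ν.glueData.isSmoothEmbedding_inr
  isOpen_range_jB := pr.isOpen_range_stepB ν hdisj hν
  cover := pr.stepA_cover ν hdisj hν
  disjoint_jB := pr.disjoint_stepB ν hdisj hν
  rel i a ha b := by
    rcases Fin.eq_castSucc_or_eq_last i with ⟨j, rfl⟩ | rfl
    · rw [Fin.snoc_castSucc]; exact pr.stepA_eq_stepB_castSucc_iff ν hdisj hν j ha b
    · rw [Fin.snoc_last, pr.stepB_last ν hdisj hν]; exact pr.stepA_eq_inr_iff ν hdisj hν ha b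

/-- The tubes of `step` are the old tubes followed by the new one. [folklore] -/
@[simp] theorem step_T [IsManifold (𝓡 3) ∞ P] (hTn : Manifold.IsSmoothEmbedding ((𝓡 1).prod 𝓘(ℝ, 𝔼 2)) (𝓡 3) ∞ Tn) :
    (pr.step ν hdisj hν hTn).T = Fin.snoc pr.T Tn := rfl

/-- The `jA` of `step` is `stepA`. [folklore] -/
@[simp] theorem step_jA [IsManifold (𝓡 3) ∞ P] (hTn : Manifold.IsSmoothEmbedding ((𝓡 1).prod 𝓘(ℝ, 𝔼 2)) (𝓡 3) ∞ Tn) :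
    (pr.step ν hdisj hν hTn).jA = pr.stepA ν := rfl

end TubePresentation

end Step

/-! ### From a tube in `S³` to a knot with an oriented tubular neighbourhood -/

section Orient

variable {T : (𝕊 1) × (𝔼 2) → 𝕊 3} (hT : Manifold.IsSmoothEmbedding ((𝓡 1).prod 𝓘(ℝ, 𝔼 2)) (𝓡 3) ∞ T)

include hT in
/-- A smoothly embedded tube `𝕊 1 × ℝ² ↪ S³` is an open embedding (invariance of domain,
`1 + 2 = 3`). [folklore] -/
theorem isOpenEmbedding_of_tube : Topology.IsOpenEmbedding T :=
  ⟨hT.isEmbedding, (Manifold.IsSmoothEmbedding.isOpenMap_of_finrank_eq hT (by simp)).isOpen_range⟩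

include hT in
/-- A smoothly embedded tube `𝕊 1 × ℝ² ↪ S³` is a local diffeomorphism (an immersion between
manifolds of the same dimension). [folklore] -/
theorem isLocalDiffeomorph_of_tube : IsLocalDiffeomorph ((𝓡 1).prod 𝓘(ℝ, 𝔼 2)) (𝓡 3) ∞ T := by
  intro q
  have hinj : Injective (mfderiv ((𝓡 1).prod 𝓘(ℝ, 𝔼 2)) (𝓡 3) T q) :=
    Manifold.IsImmersionAt.mfderiv_injective (hT.isImmersion.isImmersionAt q) (by simp)
  set A : (EuclideanSpace ℝ (Fin 1) × 𝔼 2) →L[ℝ] 𝔼 3 := mfderiv ((𝓡 1).prod 𝓘(ℝ, 𝔼 2)) (𝓡 3) T q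
  have hinjA : Injective A.toLinearMap := hinj
  let L : (EuclideanSpace ℝ (Fin 1) × 𝔼 2) ≃L[ℝ] 𝔼 3 :=
    (A.toLinearMap.linearEquivOfInjective hinjA finrank_tube_model).toContinuousLinearEquiv
  refine isLocalDiffeomorphAt_of_mfderiv isOpen_univ (mem_univ q) hT.contMDiff.contMDiffOn (by simp) L ?_
  ext1 v
  rfl

include hT in
/-- **The core of a smoothly embedded tube is a smooth knot** `u ↦ T (u, 0)` (the zero section of
the product neighbourhood `T`, `isImmersionAtOfComplement_of_eventuallyEq_prod`). [folklore] -/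
theorem isSmoothEmbedding_tube_zero : Manifold.IsSmoothEmbedding (𝓡 1) (𝓡 3) ∞ fun u : 𝕊 1 ↦ T (u, 0) := by
  haveI : Nonempty ((𝕊 1) × (𝔼 2)) := ⟨(spherePt 1, 0)⟩
  set Φ := (isOpenEmbedding_of_tube hT).toOpenPartialHomeomorph T with hΦ
  have hsrc : Φ.source = univ := by rw [hΦ, Topology.IsOpenEmbedding.toOpenPartialHomeomorph_source]
  have hΦs : ContMDiffOn ((𝓡 1).prod 𝓘(ℝ, 𝔼 2)) (𝓡 3) ∞ Φ Φ.source := hT.contMDiff.contMDiffOn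
  have hΦs' : ContMDiffOn (𝓡 3) ((𝓡 1).prod 𝓘(ℝ, 𝔼 2)) ∞ Φ.symm Φ.target := by
    rw [hΦ, Topology.IsOpenEmbedding.toOpenPartialHomeomorph_target]
    exact contMDiffOn_symm_of_isSmoothEmbedding hT (isOpenEmbedding_of_tube hT)
  have L : (EuclideanSpace ℝ (Fin 1) × 𝔼 2) ≃L[ℝ] 𝔼 3 := ContinuousLinearEquiv.ofFinrankEq (by simp)
  refine ⟨Manifold.IsImmersionOfComplement.isImmersion (F := 𝔼 2) fun u ↦ ?_,
    hT.isEmbedding.comp (isEmbedding_prodMkLeft (0 : 𝔼 2))⟩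
  exact isImmersionAtOfComplement_of_eventuallyEq_prod Φ hΦs hΦs' L (by rw [hsrc]; exact mem_univ _)
    (Filter.Eventually.of_forall fun y ↦ rfl)

/-- The core knot of a smoothly embedded tube. [folklore] -/
def knotOfTube : Knot := ⟨fun u ↦ T (u, 0), isSmoothEmbedding_tube_zero hT⟩

/-- The core knot of a tube is `u ↦ T (u, 0)`. [folklore] -/
@[simp] theorem coe_knotOfTube : ⇑(knotOfTube hT) = fun u ↦ T (u, 0) := rfl

/-- The fibre-reflected tube `(u, w) ↦ T (u, w̄)` (`fibreReflect`, `TubularNbhdOfLocalDiffeomorph.lean`)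
has the same range. [folklore] -/
theorem range_fibreReflect : range (fibreReflect T) = range T := by
  have h : range (fun q : (𝕊 1) × (𝔼 2) ↦ fibreReflDiffeo q) = univ :=
    Set.range_eq_univ.2 fun q ↦ ⟨fibreReflDiffeo.symm q, fibreReflDiffeo.apply_symm_apply q⟩
  rw [fibreReflect_eq_comp, range_comp]
  change T '' range (fun q : (𝕊 1) × (𝔼 2) ↦ fibreReflDiffeo q) = range T
  rw [h, image_univ]

/-- The fibre reflection commutes with scaling and restricts on the circle to the reflection
`reflectLast 1` (`planeFlip_coe_sphere`). [folklore] -/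
theorem planeFlip_smul_coe (t : ℝ) (v : 𝕊 1) : planeFlip (t • (v : 𝔼 2)) = t • ((reflectLast 1 v : 𝕊 1) : 𝔼 2) := by
  rw [map_smul, planeFlip_coe_sphere]

include hT in
/-- **Every smoothly embedded tube in `S³`, or its fibre reflection, is an oriented tubular
neighbourhood of its core knot** — the tree's `Knot.TubularNbhd.ofLocalDiffeomorph`
(`TubularNbhdOfLocalDiffeomorph.lean`: the frame determinant of `Knot.TubularNbhd.det_pos` has
constant sign for an injective local diffeomorphism, and the fibre reflection reverses it), read off
together with the translation of the surgery relations: `ν.glueRel a b ↔ tubeRel T a b`, or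
`↔ tubeRel T a (b.1, reflectLast 1 b.2)` in the reflected case. [folklore] -/
theorem exists_tubularNbhd_of_tube :
    ∃ ν : Knot.TubularNbhd ⇑(knotOfTube hT), range ⇑ν = range T ∧
      ((∀ (a : 𝕊 3) (b : (𝔼 2) × (𝕊 1)), ν.glueRel a b ↔ tubeRel T a b) ∨
        ∀ (a : 𝕊 3) (b : (𝔼 2) × (𝕊 1)), ν.glueRel a b ↔ tubeRel T a (b.1, reflectLast 1 b.2)) := by
  have hinj : Injective T := hT.isEmbedding.injective
  set ν := Knot.TubularNbhd.ofLocalDiffeomorph (K := knotOfTube hT) (isLocalDiffeomorph_of_tube hT)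
    hinj (fun x ↦ rfl) with hν
  refine ⟨ν, ?_⟩
  rcases Knot.TubularNbhd.ofLocalDiffeomorph_apply_or (K := knotOfTube hT) (isLocalDiffeomorph_of_tube hT)
    hinj (fun x ↦ rfl) with h | h
  · have hcoe : (⇑ν : (𝕊 1) × (𝔼 2) → 𝕊 3) = T := by rw [hν]; exact funext h
    refine ⟨by rw [hcoe], Or.inl fun a b ↦ ?_⟩
    show (∃ (u : 𝕊 1) (t : ℝ), t ∈ Ioo (0 : ℝ) 1 ∧ b.1 = t • (u : 𝔼 2) ∧ a = ν (u, t • (b.2 : 𝔼 2))) ↔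
      ∃ (u : 𝕊 1) (t : ℝ), t ∈ Ioo (0 : ℝ) 1 ∧ b.1 = t • (u : 𝔼 2) ∧ a = T (u, t • (b.2 : 𝔼 2))
    rw [hcoe]
  · have hcoe : (⇑ν : (𝕊 1) × (𝔼 2) → 𝕊 3) = fibreReflect T := by rw [hν]; exact funext h
    refine ⟨by rw [hcoe, range_fibreReflect], Or.inr fun a b ↦ ?_⟩
    show (∃ (u : 𝕊 1) (t : ℝ), t ∈ Ioo (0 : ℝ) 1 ∧ b.1 = t • (u : 𝔼 2) ∧ a = ν (u, t • (b.2 : 𝔼 2))) ↔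
      ∃ (u : 𝕊 1) (t : ℝ), t ∈ Ioo (0 : ℝ) 1 ∧ b.1 = t • (u : 𝔼 2) ∧
        a = T (u, t • ((reflectLast 1 b.2 : 𝕊 1) : 𝔼 2))
    rw [hcoe]
    simp only [fibreReflect, planeFlip_smul_coe]

end Orient

/-! ### From a tube presentation to an integral surgery presentation on a framed link -/

section ToLink

/-- The reflection `(p, v) ↦ (p, v̄)` of the open solid torus in the circle factor only
(`v̄ = reflectLast 1 v`; the tree's `solidTorusFlip` reflects both factors). [folklore] -/
def torusFlipFun (b : ↥solidTorus) : ↥solidTorus :=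
  ⟨((b : (𝔼 2) × (𝕊 1)).1, reflectLast 1 (b : (𝔼 2) × (𝕊 1)).2), by
    have := b.2; rw [mem_solidTorus_iff] at this ⊢; exact this⟩

/-- The reflection of the solid torus in coordinates: `(p, v) ↦ (p, v̄)`. [folklore] -/
@[simp] theorem coe_torusFlipFun (b : ↥solidTorus) :
    (torusFlipFun b : (𝔼 2) × (𝕊 1)) = ((b : (𝔼 2) × (𝕊 1)).1, reflectLast 1 (b : (𝔼 2) × (𝕊 1)).2) := rfl

/-- The reflection of the solid torus is an involution. [folklore] -/
@[simp] theorem torusFlipFun_torusFlipFun (b : ↥solidTorus) : torusFlipFun (torusFlipFun b) = b := by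
  apply Subtype.ext; simp

/-- The reflection of the solid torus is `C^∞`. [folklore] -/
theorem contMDiff_torusFlipFun :
    ContMDiff (𝓘(ℝ, 𝔼 2).prod (𝓡 1)) (𝓘(ℝ, 𝔼 2).prod (𝓡 1)) ∞ torusFlipFun := by
  intro b
  rw [← contMDiffWithinAt_univ, ← ContMDiffWithinAt.subtypeVal_comp_iff, contMDiffWithinAt_univ]
  have h1 : ContMDiff (𝓘(ℝ, 𝔼 2).prod (𝓡 1)) 𝓘(ℝ, 𝔼 2) ∞ fun b : ↥solidTorus ↦ (b : (𝔼 2) × (𝕊 1)).1 :=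
    contMDiff_fst.comp contMDiff_subtype_val
  have h2 : ContMDiff (𝓘(ℝ, 𝔼 2).prod (𝓡 1)) (𝓡 1) ∞ fun b : ↥solidTorus ↦ (b : (𝔼 2) × (𝕊 1)).2 :=
    contMDiff_snd.comp contMDiff_subtype_val
  exact (h1.prodMk ((reflectLastDiffeo 1).contMDiff.comp h2)).contMDiffAt

/-- The reflection of the open solid torus as a diffeomorphism (an involution). [folklore] -/
def torusFlip : ↥solidTorus ≃ₘ⟮𝓘(ℝ, 𝔼 2).prod (𝓡 1), 𝓘(ℝ, 𝔼 2).prod (𝓡 1)⟯ ↥solidTorus where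
  toFun := torusFlipFun
  invFun := torusFlipFun
  left_inv := torusFlipFun_torusFlipFun
  right_inv := torusFlipFun_torusFlipFun
  contMDiff_toFun := contMDiff_torusFlipFun
  contMDiff_invFun := contMDiff_torusFlipFun

/-- The diffeomorphism `torusFlip` is `torusFlipFun` as a map. [folklore] -/
@[simp] theorem coe_torusFlip : ⇑torusFlip = torusFlipFun := rfl

variable {k : ℕ} {P : Type v} [TopologicalSpace P] [ChartedSpace (𝔼 3) P] (pr : TubePresentation k P)

namespace TubePresentation

/-- **The link of a tube presentation**: the cores of the tubes. [folklore] -/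
def link : Link (Fin k) where
  component i := knotOfTube (pr.isSmoothEmbedding_T i)
  disjoint i j hij := by
    refine Set.disjoint_left.2 fun x ⟨u, hu⟩ ⟨u', hu'⟩ ↦ ?_
    simp only [coe_knotOfTube] at hu hu'
    exact Set.disjoint_left.1 (pr.disjoint_T hij) ⟨(u, 0), hu⟩ ⟨(u', 0), hu'⟩

/-- The components of the link of a presentation are the cores of its tubes. [folklore] -/
@[simp] theorem coe_link_component (i : Fin k) : ⇑(pr.link.component i) = fun u ↦ pr.T i (u, 0) := rfl

/-- The carrier of the link of a presentation is the union of the cores. [folklore] -/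
theorem link_carrier : pr.link.carrier = tubesCore pr.T := rfl

/-- The complement of the link of a presentation is the complement of the cores. [folklore] -/
theorem link_complement : pr.link.complement = pr.compl := rfl

/-- Per component: an oriented tubular neighbourhood and the matching solid-torus embedding. [folklore] -/
theorem exists_tubularNbhd_jB (i : Fin k) :
    ∃ (ν : Knot.TubularNbhd ⇑(pr.link.component i)) (jBi : ↥solidTorus → P),
      range ⇑ν = range (pr.T i) ∧ Manifold.IsSmoothEmbedding (𝓘(ℝ, 𝔼 2).prod (𝓡 1)) (𝓡 3) ∞ jBi ∧
      range jBi = range (pr.jB i) ∧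
      ∀ (a : 𝕊 3), a ∉ tubesCore pr.T → ∀ b : ↥solidTorus, pr.jA a = jBi b ↔ ν.glueRel a (b : (𝔼 2) × (𝕊 1)) := by
  obtain ⟨ν, hrange, hrel | hrel⟩ := exists_tubularNbhd_of_tube (pr.isSmoothEmbedding_T i)
  · exact ⟨ν, pr.jB i, hrange, pr.isSmoothEmbedding_jB i, rfl, fun a ha b ↦ by
      rw [pr.rel i a ha b]; exact (hrel a b).symm⟩
  · refine ⟨ν, pr.jB i ∘ torusFlip, hrange, (pr.isSmoothEmbedding_jB i).comp_diffeomorph torusFlip, ?_,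
      fun a ha b ↦ ?_⟩
    · have h : range (fun b : ↥solidTorus ↦ torusFlip b) = univ :=
        Set.range_eq_univ.2 fun b ↦ ⟨torusFlip.symm b, torusFlip.apply_symm_apply b⟩
      rw [range_comp]
      change pr.jB i '' range (fun b : ↥solidTorus ↦ torusFlip b) = range (pr.jB i)
      rw [h, image_univ]
    · rw [comp_apply, coe_torusFlip, pr.rel i a ha, coe_torusFlipFun]
      exact (hrel a _).symm

/-- **A tube presentation is an integral surgery presentation on a framed link**: orient the
tubes (`exists_tubularNbhd_of_tube`, reflecting the fibre and the new solid torus when needed) and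
read off the framings, which exist by `Knot.TubularNbhd.exists_hasFraming` (the knot group is
normally generated by the meridian; Rolfsen, *Knots and Links* (1976), §9.F). [cite: Rolfsen1976, §9.F] -/
theorem exists_isIntegralSurgeryLink [IsManifold (𝓡 3) ∞ P] :
    ∃ (m : Fin k → ℤ), IsIntegralSurgeryLink (𝓡 3) P pr.link m := by
  choose ν jB hrange hB hrangeB hrel using pr.exists_tubularNbhd_jB
  choose m hm using fun i ↦ Knot.TubularNbhd.exists_hasFraming (ν i)
  refine ⟨m, ν, hm, ?_, fun a : ↥pr.link.complement ↦ pr.jA a, jB, ?_, ?_, fun i ↦ ⟨hB i, ?_⟩, ?_, ?_, ?_⟩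
  · intro i j hij
    rw [hrange, hrange]
    exact pr.disjoint_T hij
  · exact pr.isSmoothEmbedding_jA
  · have : range (fun a : ↥pr.link.complement ↦ pr.jA a) = pr.jA '' (tubesCore pr.T)ᶜ := by
      ext p; constructor
      · rintro ⟨⟨a, ha⟩, rfl⟩; exact ⟨a, ha, rfl⟩
      · rintro ⟨a, ha, rfl⟩; exact ⟨⟨a, ha⟩, rfl⟩
    rw [this]; exact pr.isOpen_image_jA
  · rw [hrangeB]; exact pr.isOpen_range_jB i
  · have : range (fun a : ↥pr.link.complement ↦ pr.jA a) = pr.jA '' (tubesCore pr.T)ᶜ := by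
      ext p; constructor
      · rintro ⟨⟨a, ha⟩, rfl⟩; exact ⟨a, ha, rfl⟩
      · rintro ⟨a, ha, rfl⟩; exact ⟨⟨a, ha⟩, rfl⟩
    rw [this]
    have hB' : (⋃ i, range (jB i)) = ⋃ i, range (pr.jB i) := by simp only [hrangeB]
    rw [hB']
    exact pr.cover
  · intro i j hij
    rw [hrangeB, hrangeB]
    exact pr.disjoint_jB hij
  · rintro i ⟨a, ha⟩ b
    exact hrel i a ha b

end TubePresentation

end ToLink

/-! ### Lickorish's iteration: one surgery per Dehn twist, at doubling depths -/

section Iterate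

variable {H : Type u} [TopologicalSpace H] [T2Space H] [CompactSpace H]
  [ChartedSpace (EuclideanHalfSpace 3) H] [IsManifold (𝓡∂ 3) ∞ H]
  {H' : Type u} [TopologicalSpace H'] [CompactSpace H']
  [ChartedSpace (EuclideanHalfSpace 3) H'] [IsManifold (𝓡∂ 3) ∞ H']
  {b : BoundaryData (𝓡∂ 3) H (𝓡 2)} {b' : BoundaryData (𝓡∂ 3) H' (𝓡 2)}
  [CompactSpace b.carrier] [T2Space b.carrier]
  (c : b.Collar) {i₀ : b.carrier → b'.carrier} {jH₀ : H → 𝕊 3} {jH₀' : H' → 𝕊 3}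
  (h₀ : IsBoundaryGluingWith b b' i₀ (𝓡 3) jH₀ jH₀')

/-- **The state of the iteration** after some surgeries: a closed `3`-manifold `P` (in `Type`),
glued from `H` and `H'` along `φ` by `jH`, `jH'`, presented by surgery on `k` tubes in `S³`, such
that (1) `jH` agrees with `jA ∘ jH₀` off the collar and on collar points of height `≥ D`, and
(2) all tubes lie in the image of the collar part of height `< D`. [folklore] -/
def IterGood (φ : b.carrier → b'.carrier) (k : ℕ) (D : ℝ) : Prop :=
  ∃ (P : Type) (_ : TopologicalSpace P) (_ : T2Space P) (_ : CompactSpace P) (_ : ChartedSpace (𝔼 3) P)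
    (_ : IsManifold (𝓡 3) ∞ P) (jH : H → P) (jH' : H' → P) (pr : TubePresentation k P),
    IsBoundaryGluingWith b b' φ (𝓡 3) jH jH' ∧
    (∀ m : H, (m ∉ range c ∨ ∃ q, c q = m ∧ D ≤ (q.2 : ℝ)) → jH m = pr.jA (jH₀ m)) ∧
    ∀ i q, pr.T i q ∈ jH₀ '' (c '' {q' : b.carrier × Set.Icc (0 : ℝ) 1 | (q'.2 : ℝ) < D})

omit [T2Space H] [CompactSpace H] [IsManifold (𝓡∂ 3) ∞ H] [CompactSpace H'] [IsManifold (𝓡∂ 3) ∞ H']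
  [CompactSpace b.carrier] [T2Space b.carrier] in
include h₀ in
/-- **The initial state**: `S³ = H ∪_{i₀} H'` itself, presented by no surgery. [folklore] -/
theorem iterGood_init : IterGood c (jH₀ := jH₀) i₀ 0 0 :=
  ⟨𝕊 3, inferInstance, inferInstance, inferInstance, inferInstance, inferInstance, jH₀, jH₀',
    TubePresentation.sphere, h₀, fun _ _ ↦ rfl, fun i ↦ i.elim0⟩

include h₀ in
/-- **One step of the iteration**: surgery along the tube of the next Dehn twist `σ` (with annulus
chart `e`) at depth `d`, provided the current threshold is `D ≤ 7d/8`; the new threshold is `3d/2`.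
[cite: LickorishAnnals1962, proof of Thm. 2 (p. 539)] -/
theorem iterGood_step {φ : b.carrier → b'.carrier} {k : ℕ} {D d : ℝ} (hd0 : 0 < d) (hd : d ≤ 1 / 3)
    (hDd : D ≤ 7 * d / 8) (st : IterGood c (jH₀ := jH₀) φ k D)
    {σ : b.carrier ≃ₘ⟮𝓡 2, 𝓡 2⟯ b.carrier} (e : AnnulusChart (𝓡 2) b.carrier)
    (h1 : ∀ p, σ (e p) = e (dehnTwistModel p)) (h2 : ∀ x, x ∉ range e → σ x = x) :
    IterGood c (jH₀ := jH₀) (φ ∘ σ) (k + 1) (3 * d / 2) := by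
  obtain ⟨P, _, _, _, _, _, jH, jH', pr, h, inv1, inv2⟩ := st
  -- the tube of the twist in `P` and in `S³`
  set ν := tube c e h hd0 hd with hν
  set Tn : (𝕊 1) × (𝔼 2) → 𝕊 3 := tubeP c e jH₀ d with hTn
  have hTn_emb : Manifold.IsSmoothEmbedding ((𝓡 1).prod 𝓘(ℝ, 𝔼 2)) (𝓡 3) ∞ Tn := isSmoothEmbedding_tubeP c e h₀ hd0 hd
  -- heights of tube points
  have hheight : ∀ q, 7 * d / 8 < ((tubeCyl e d q).2 : ℝ) ∧ ((tubeCyl e d q).2 : ℝ) < 9 * d / 8 := fun q ↦ by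
    rw [coe_tubeCyl_snd e hd0.le hd]
    have := tubeProfile_snd_mem q
    constructor <;> nlinarith [this.1, this.2]
  have hdeep : ∀ q, D ≤ ((tubeCyl e d q).2 : ℝ) := fun q ↦ hDd.trans (hheight q).1.le
  -- (a) `ν = jA ∘ Tn`
  have hνT : ∀ q, ν.toFun q = pr.jA (Tn q) := fun q ↦ by
    rw [hν, tube_toFun, tubeP_apply, hTn, tubeP_apply, tubeM]
    exact inv1 _ (Or.inr ⟨tubeCyl e d q, rfl, hdeep q⟩)
  -- (b) the new tube misses the old ones
  have hdisj : ∀ i, Disjoint (range Tn) (range (pr.T i)) := fun i ↦ by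
    refine Set.disjoint_left.2 ?_
    rintro _ ⟨q, rfl⟩ ⟨q'', hq''⟩
    obtain ⟨m, ⟨q', hq', rfl⟩, hm⟩ := inv2 i q''
    rw [hq'', hTn, tubeP_apply, tubeM] at hm
    have := c.injective (h₀.injective_left hm)
    rw [this] at hq'
    exact absurd hq' (not_lt.2 (hdeep q))
  -- the new state
  refine ⟨ν.Surgered, inferInstance, inferInstance, inferInstance, inferInstance, inferInstance,
    twistedEmb c e h hd0 hd, rightEmb c e h hd0 hd, pr.step ν hdisj hνT hTn_emb,
    isBoundaryGluingWith_twistedEmb_of_dehnTwist c e h hd0 hd h1 h2, fun m hm ↦ ?_, fun i q ↦ ?_⟩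
  · -- (1) deep points: `twistedEmb m = inl (jH m) = inl (jA (jH₀ m)) = stepA (jH₀ m)`
    have hm' : m ∉ range c ∨ ∃ q, c q = m ∧ D ≤ (q.2 : ℝ) := by
      rcases hm with hm | ⟨q, rfl, hq⟩
      · exact Or.inl hm
      · exact Or.inr ⟨q, rfl, by linarith⟩
    have hfix : c.twistExtensionInv e d m = m := by
      rcases hm with hm | ⟨q, rfl, hq⟩
      · exact c.twistExtensionInv_of_not_mem e d hm
      · exact c.twistExtensionInv_apply_of_le e hd0 hq
    have hmK : m ∉ c.twistCore e d := by
      rintro ⟨u, rfl⟩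
      rcases hm with hm | ⟨q, hq, hq'⟩
      · exact hm (mem_range_self _)
      · have h2 : (q.2 : ℝ) = d := by
          have := congrArg (fun q : b.carrier × Set.Icc (0 : ℝ) 1 ↦ (q.2 : ℝ)) (c.injective hq)
          simpa [coe_projIcc_unit_of_mem hd0.le (show d ≤ 1 by linarith)] using this
        linarith
    have hjH : jH m = pr.jA (jH₀ m) := inv1 m hm'
    -- `jA (jH₀ m)` is off the core circle of `ν`
    have hmem : pr.jA (jH₀ m) ∈ ν.complement := by
      rw [TubeNbhd.mem_complement_iff]
      rintro ⟨u, hu⟩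
      rw [← hjH] at hu
      have : tubeM c e d (u, 0) = m := h.injective_left hu
      exact hmK (this ▸ tubeM_zero_mem_twistCore c e u)
    rw [TubePresentation.step_jA, pr.stepA_apply ν hmem, twistedEmb_of_not_mem c e h hd0 hd hmK]
    congr 1
    apply Subtype.ext
    rw [coe_offCore c e h hd0 hd hmK, hfix, hjH]
  · -- (2) all tubes below height `3d/2`
    rw [TubePresentation.step_T]
    rcases Fin.eq_castSucc_or_eq_last i with ⟨j, rfl⟩ | rfl
    · rw [Fin.snoc_castSucc]
      obtain ⟨m, ⟨q', hq', rfl⟩, hm⟩ := inv2 j q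
      have hlt : (q'.2 : ℝ) < D := hq'
      exact ⟨c q', ⟨q', show (q'.2 : ℝ) < 3 * d / 2 by linarith, rfl⟩, hm⟩
    · rw [Fin.snoc_last]
      exact ⟨tubeM c e d q, ⟨tubeCyl e d q, by
        show ((tubeCyl e d q).2 : ℝ) < 3 * d / 2; linarith [(hheight q).2], rfl⟩, rfl⟩

/-! #### The whole list of twists -/

/-- The composite `σ₁ ∘ σ₂ ∘ ⋯ ∘ σₙ` of a list of self-maps (head applied last). [folklore] -/
def compList {X : Type*} : List (X → X) → X → X
  | [] => id
  | σ :: l => σ ∘ compList l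

/-- The composite of the empty list is the identity. [folklore] -/
@[simp] theorem compList_nil {X : Type*} : compList ([] : List (X → X)) = id := rfl
/-- The composite of `σ :: l` is `σ ∘ compList l`. [folklore] -/
@[simp] theorem compList_cons {X : Type*} (σ : X → X) (l : List (X → X)) : compList (σ :: l) = σ ∘ compList l := rfl

/-- The depth used for the head of the remaining list: `(1/3) · 2^{-(length of the tail)}`. [folklore] -/
def headDepth {α : Type*} : List α → ℝ
  | [] => 1
  | _ :: l => (1 / 3) * (1 / 2) ^ l.length

/-- The head depth is positive. [folklore] -/
theorem headDepth_pos {α : Type*} (l : List α) : 0 < headDepth l := by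
  cases l with
  | nil => simp [headDepth]
  | cons _ l => simp only [headDepth]; positivity

/-- After a step at depth `d = headDepth (σ :: l')`, the new threshold `3d/2` is admissible for
the tail: `3d/2 ≤ 7/8 · headDepth l'`. [folklore] -/
theorem threshold_le_tail {α : Type*} (σ : α) (l' : List α) :
    3 * headDepth (σ :: l') / 2 ≤ 7 * headDepth l' / 8 := by
  cases l' with
  | nil => norm_num [headDepth]
  | cons σ' l'' =>
    simp only [headDepth, List.length_cons, pow_succ]
    nlinarith [pow_pos (show (0 : ℝ) < 1 / 2 by norm_num) l''.length]

include h₀ in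
/-- **The iteration over a list of Dehn twists** (Lickorish (1962), p. 539: the twists are
performed one after the other, each at the expense of one more toral hole, the holes being taken
at different depths of the collar). [cite: LickorishAnnals1962, proof of Thm. 2 (p. 539)] -/
theorem iterGood_list (l : List (b.carrier ≃ₘ⟮𝓡 2, 𝓡 2⟯ b.carrier)) (hl : ∀ σ ∈ l, IsDehnTwist (𝓡 2) σ)
    {φ : b.carrier → b'.carrier} {k : ℕ} {D : ℝ} (hD : D ≤ 7 * headDepth l / 8)
    (st : IterGood c (jH₀ := jH₀) φ k D) :
    ∃ D', IterGood c (jH₀ := jH₀) (φ ∘ compList (l.map fun σ : b.carrier ≃ₘ⟮𝓡 2, 𝓡 2⟯ b.carrier ↦ (σ : b.carrier → b.carrier)))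
      (k + l.length) D' := by
  induction l generalizing φ k D with
  | nil => exact ⟨D, by simpa using st⟩
  | cons σ l' ih =>
    set d := headDepth (σ :: l') with hd_def
    have hd0 : 0 < d := headDepth_pos _
    have hd1 : d ≤ 1 / 3 := by
      rw [hd_def, headDepth]
      have : ((1 : ℝ) / 2) ^ l'.length ≤ 1 := pow_le_one₀ (by norm_num) (by norm_num)
      nlinarith
    obtain ⟨e, h1, h2⟩ := (isDehnTwist_iff_annulusChart σ).1 (hl σ (List.mem_cons_self))
    have st' := iterGood_step c h₀ hd0 hd1 (by linarith) st e h1 h2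
    obtain ⟨D', hD'⟩ := ih (fun τ hτ ↦ hl τ (List.mem_cons_of_mem σ hτ)) (threshold_le_tail σ l') st'
    refine ⟨D', ?_⟩
    rw [show k + (σ :: l').length = k + 1 + l'.length by simp [List.length_cons]; omega]
    simpa [Function.comp_assoc] using hD'

include c h₀ in
/-- **Lickorish's realisation of a product of Dehn twists by surgeries** (in `S³`): if
`S³ = H ∪_{i₀} H'` (explicit gluing `h₀`), then for every list of Dehn twists `σ₁, …, σₙ` of `∂H`
there is a closed `3`-manifold `P` which is both `H ∪_{i₀ ∘ σ₁ ∘ ⋯ ∘ σₙ} H'` and an integral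
surgery on a framed `n`-component link in `S³` (`Literature.Topology.FourManifolds.IsIntegralSurgeryLink`).
Lickorish, Ann. of Math. 76 (1962), proof of Thm. 2, pp. 538–540; Schultens (2014), Lemma 7.3.4.
[cite: LickorishAnnals1962, proof of Thm. 2 (pp. 538–540)] -/
theorem exists_surgery_of_dehnTwists (l : List (b.carrier ≃ₘ⟮𝓡 2, 𝓡 2⟯ b.carrier))
    (hl : ∀ σ ∈ l, IsDehnTwist (𝓡 2) σ) :
    ∃ (P : Type) (_ : TopologicalSpace P) (_ : T2Space P) (_ : CompactSpace P) (_ : ChartedSpace (𝔼 3) P)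
      (_ : IsManifold (𝓡 3) ∞ P) (jH : H → P) (jH' : H' → P),
      IsBoundaryGluingWith b b' (i₀ ∘ compList (l.map fun σ : b.carrier ≃ₘ⟮𝓡 2, 𝓡 2⟯ b.carrier ↦
        (σ : b.carrier → b.carrier))) (𝓡 3) jH jH' ∧
      ∃ (L : Link (Fin l.length)) (m : Fin l.length → ℤ), IsIntegralSurgeryLink (𝓡 3) P L m := by
  have hD : (0 : ℝ) ≤ 7 * headDepth l / 8 := by have := headDepth_pos l; positivity
  obtain ⟨D', P, _, _, _, _, _, jH, jH', pr, h, -, -⟩ := iterGood_list c h₀ l hl hD (iterGood_init c h₀)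
  rw [zero_add] at pr
  obtain ⟨m, hm⟩ := pr.exists_isIntegralSurgeryLink
  exact ⟨P, ‹_›, ‹_›, ‹_›, ‹_›, ‹_›, jH, jH', h, pr.link, m, hm⟩

end Iterate

end LickorishTwist

end Literature.Topology.FourManifolds
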